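import Summits.BirchSwinnertonDyer.BirchSwinnertonDyer.Theses.TameQuarticManinParity
import Summits.BirchSwinnertonDyer.Rank1Residual.O6.X3WildOfKMCTorsionFreeMember
import Summits.BirchSwinnertonDyer.Rank1Residual.Additive.GordKodairaType
import Literature.NumberTheory.EllipticCurves.IsogenyNeronScalingMinimalDiscriminantDirectionProofs
import Literature.NumberTheory.EllipticCurves.IsogenyOddKernelFourthPowerProofs
import Literature.NumberTheory.EllipticCurves.LatticeInclusionIsogenyComplexPointsProofs
import Literature.NumberTheory.DiophantineGeometry.ConductorAdditiveProofs
import Literature.NumberTheory.DiophantineGeometry.TateAlgorithmAdditiveProofs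
import HarnessLib

/-!
# Route `TameQuarticManinParity`, LINE 20 (bsd-idea-3 g7), item F19♭ `TprimeRedKodairaThreeForcesNeronUnit`
# (stmt-BirchSwinnertonDyer-27922) — PROVED BY NAME, OUTRIGHT (no Gealy–Klagsbrun fact): every index-3
# Néron sublattice relation `αΛ_W ⊆ Λ_{W₂}` out of a (t′) curve of Kodaira type III at `3` has `3 ∤ α`

Cell `pub/bsd-wall`, D-0145 line `route-BirchSwinnertonDyer-TeichmullerTwistDescent`, seat `bsd-line-ttd-p1` g9,
working the planner-of-record's TQMP LINE 20. BSD is NOT proved by this; Manin's conjecture is not proved by this;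
E19/U19/K19 and the hard half `TprimeRedManinUnitOfThreeDvdDegree` (stmt-24627) stay OPEN. With the landed glues
G20 (stmt-27892) and G20♭ (stmt-27923) this item records U19 ⟺ E19 ∧ F19 on the route; it is the critic's
(V103) «forcing lemma», here a theorem.

## Statement (verbatim the route decl)

For `W/ℚ` globally minimal with `Addv W 3`, `SubTprime W 3`, `v₃(Δ_min W) = 3`, every globally minimal `W₂`,
Néron period pairs `L, L₂` and `α ∈ ℤ` with `αΛ_W ⊆ Λ_{W₂}` of index `3`: `3 ∤ α`.

## Proof (tree theorems only; the local-local / formal-group step of Gealy–Klagsbrun is replaced by an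
## algebraic parity)

* the lattice relation IS a `ℚ`-isogeny `φ : W → W₂` of degree `3`
  (`exists_isogeny_degree_eq_relIndex_of_isNeronLatticeOf`, Silverman VI.4.1(b));
* PARITY (Dokchitser–Dokchitser 2015 Thm. 5/6 at `p = 3`, the tree's
  `Isogeny.padicValInt_minimalDiscriminantInt_modEq_four_of_degree_eq_three`, from Vélu + Galois descent):
  `v₃(Δ_min W₂) ≡ 3·v₃(Δ_min W) = 9 ≡ 1 (mod 4)`;
* `W₂` is additive at `3` (isogeny invariance, `Addv.of_isIsogenous_of_padicValRat_j_nonneg`; (t′) is potentially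
  good), so `v₃(Δ_min W₂) ≥ 2` (Ogg: `2 ≤ f₃ ≤ v₃ Δ_min`, the tree's `two_le_conductorExponent_iff_holds` and
  `conductorExponent_le_ordMinimalDiscriminant`);
* ORIENTATION (Dokchitser–Dokchitser Table 1, column `φ^*ω'/ω` = Gealy–Klagsbrun (iii), the tree's
  `dvd_and_not_dvd_neronScaling_of_padicValInt_minimalDiscriminantInt_lt_of_relIndex_eq`, from the integrality of
  the multiplier over a good-reduction field): a RISE `v₃(Δ_min W) < v₃(Δ_min W₂)` forces `3 ∤ α`.
So if `3 ∣ α` then `v₃(Δ_min W₂) ≤ 3`, `≥ 2`, and `≡ 1 (mod 4)` — impossible. (In particular the type always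
flips, III → III*: `v₃(Δ_min W₂) ≥ 5`.)

Design: theorems only; no definition, no named fact, no `sorry`; axioms `propext`, `Classical.choice`,
`Quot.sound`. References: [DokchitserDokchitser2015LocalInvariants] Thm. 5, Thm. 6, Table 1;
[GealyKlagsbrun2017] Thm. 1; [SilvermanAEC2009] VI.4.1(b), VII.5.5; [SilvermanATAEC1994] IV.10.2, IV.11.1.
-/

set_option autoImplicit false
-- D-0017: single-problem summit, so `Summit.BirchSwinnertonDyer.BirchSwinnertonDyer.…` repeats a namespace BY DESIGN.
set_option linter.dupNamespace false

noncomputable section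

open scoped Classical

namespace Summit.BirchSwinnertonDyer.BirchSwinnertonDyer.Theorems.TameQuarticManinParity

open WeierstrassCurve IsDedekindDomain
  Literature.NumberTheory.EllipticCurves Literature.NumberTheory.EllipticCurves.ModularForms
  Literature.NumberTheory.EllipticCurves.Rank1Residual
  Literature.NumberTheory.DiophantineGeometry
  Summit.BirchSwinnertonDyer.Rank1Residual Summit.BirchSwinnertonDyer.Rank1Residual.Additive
  Summit.BirchSwinnertonDyer.BirchSwinnertonDyer.Theses.TameQuarticManinParity

/-- **`v₃(Δ_min) ≥ 2` at an additive `3`** (Ogg's formula `f = v(Δ_min) + 1 − m` with `m ≥ 1`, and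
`f ≥ 2` for additive reduction). [cite: SilvermanATAEC1994, IV.10.2(c) and IV.11.1 (Ogg's formula)] -/
theorem two_le_padicValInt_minimalDiscriminantInt_three_of_addv (V : WeierstrassCurve ℚ) [V.IsElliptic]
    [V.IsGloballyMinimal] (hadd : Addv V 3) : 2 ≤ padicValInt 3 V.minimalDiscriminantInt := by
  haveI : PerfectField (IsLocalRing.ResidueField ((placeOf 3).adicCompletionIntegers ℚ)) :=
    PerfectField.ofFinite
  have hk := isAdditive_kodairaSymbolAt_placeOf_of_addv V 3 hadd
  have hA : V.HasAdditiveReductionAt (placeOf 3) :=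
    (isAdditive_kodairaSymbolAt_iff_holds (placeOf 3) V).mp hk
  have hf : 2 ≤ V.conductorExponent (placeOf 3) :=
    (V.two_le_conductorExponent_iff_holds (placeOf 3)).mpr hA
  have hle := V.conductorExponent_le_ordMinimalDiscriminant (placeOf 3)
  rw [ordMinimalDiscriminant_placeOf_eq V 3] at hle
  omega

/-- **F19♭ `TprimeRedKodairaThreeForcesNeronUnit` (stmt-BirchSwinnertonDyer-27922), by name.** On a (t′) row
of Kodaira type III at `3` (`Addv W 3`, `SubTprime W 3`, `v₃(Δ_min W) = 3`), every index-`3` Néron sublattice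
relation `αΛ_W ⊆ Λ_{W₂}` (`W₂/ℚ` globally minimal, `α ∈ ℤ`) has `3 ∤ α`: degree-`3` isogeny (Silverman
VI.4.1(b)) + parity `v₃(Δ_min W₂) ≡ 1 (mod 4)` (Dokchitser–Dokchitser Thm. 5/6) + `v₃(Δ_min W₂) ≥ 2`
(additive) + the rise clause of the orientation law (Dokchitser–Dokchitser Table 1 / Gealy–Klagsbrun (iii)).
[cite: DokchitserDokchitser2015LocalInvariants, Thm. 5, Thm. 6 and Table 1] [cite: GealyKlagsbrun2017, Thm. 1 (iii)]
[cite: SilvermanAEC2009, Thm. VI.4.1(b)] -/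
theorem tprimeRedKodairaThreeForcesNeronUnit_proof : TprimeRedKodairaThreeForcesNeronUnit := by
  intro W _ _ hadd ht hv3 W₂ _ _ L L₂ α hL hL₂ hle hidx
  -- a complex embedding of `ℚ̄` (for the lattice ↔ isogeny dictionary)
  haveI : Algebra.IsAlgebraic ℚ (AlgebraicClosure ℚ) := AlgebraicClosure.isAlgebraic ℚ
  letI : Algebra (AlgebraicClosure ℚ) ℂ :=
    (IsAlgClosed.lift : AlgebraicClosure ℚ →ₐ[ℚ] ℂ).toRingHom.toAlgebra
  haveI : IsScalarTower ℚ (AlgebraicClosure ℚ) ℂ :=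
    IsScalarTower.of_algebraMap_eq' (Subsingleton.elim _ _)
  -- (t′) is potentially good at `3`
  have hj : 0 ≤ padicValRat 3 W.j := not_lt.mp ht.1
  -- `α ≠ 0`: an index-`3` image of `Λ_W` is not `0` (`Λ₂ ≅ ℤ²` is infinite)
  have hα0 : α ≠ 0 := by
    intro h
    subst h
    have hbot : L.lattice.toAddSubgroup.map (AddMonoidHom.mulLeft ((0 : ℤ) : ℂ)) = ⊥ := by
      rw [eq_bot_iff]
      rintro z ⟨y, -, rfl⟩
      simp
    rw [hbot, AddSubgroup.relIndex_bot_left] at hidx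
    haveI : Infinite L₂.lattice :=
      Infinite.of_injective L₂.latticeEquivProd.symm L₂.latticeEquivProd.symm.injective
    have h0 : Nat.card L₂.lattice.toAddSubgroup = 0 := Nat.card_eq_zero_of_infinite (α := L₂.lattice)
    omega
  have hαC : (α : ℂ) ≠ 0 := by exact_mod_cast hα0
  have hαQ : (α : ℚ) ≠ 0 := by exact_mod_cast hα0
  -- the lattice relation is a `ℚ`-isogeny of degree `[Λ₂ : αΛ] = 3`
  have hsub : (L.mulLeft ((α : ℚ) : ℂ) (by exact_mod_cast hαQ)).lattice.toAddSubgroup =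
      L.lattice.toAddSubgroup.map (AddMonoidHom.mulLeft (α : ℂ)) := by
    ext z
    simp only [Submodule.mem_toAddSubgroup, PeriodPair.mem_mulLeft_lattice, AddSubgroup.mem_map,
      AddMonoidHom.coe_mulLeft, Rat.cast_intCast]
    constructor
    · intro hz
      exact ⟨_, hz, by rw [mul_inv_cancel_left₀ hαC]⟩
    · rintro ⟨y, hy, rfl⟩
      rwa [inv_mul_cancel_left₀ hαC]
  obtain ⟨φ, -, -, -, -, hdeg⟩ := exists_isogeny_degree_eq_relIndex_of_isNeronLatticeOf hL hL₂ hαQ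
    (by intro z hz; rw [Rat.cast_intCast]; exact hle z hz)
  have hdeg3 : φ.degree = 3 := by rw [hdeg, hsub, hidx]
  -- `W₂` is additive at `3`, so `v₃(Δ_min W₂) ≥ 2`
  obtain ⟨hadd₂, -⟩ := Addv.of_isIsogenous_of_padicValRat_j_nonneg hadd hj ⟨φ⟩
  have h2 := two_le_padicValInt_minimalDiscriminantInt_three_of_addv W₂ hadd₂
  -- parity: `3·3 ≡ v₃(Δ_min W₂) (mod 4)`
  have hpar := φ.padicValInt_minimalDiscriminantInt_modEq_four_of_degree_eq_three hdeg3 3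
  rw [hv3, Int.modEq_iff_dvd] at hpar
  obtain ⟨m, hm⟩ := hpar
  -- orientation: a rise forces `3 ∤ α`
  obtain ⟨-, hrise⟩ :=
    dvd_and_not_dvd_neronScaling_of_padicValInt_minimalDiscriminantInt_lt_of_relIndex_eq W W₂ 3 L L₂ α
      hL hL₂ hle hidx hj
  intro h3α
  have hle3 : padicValInt 3 W₂.minimalDiscriminantInt ≤ 3 := by
    by_contra hlt
    exact hrise (by rw [hv3]; omega) h3α
  omega

end Summit.BirchSwinnertonDyer.BirchSwinnertonDyer.Theorems.TameQuarticManinParity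

end
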